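import Mathlib
import Literature.NumberTheory.LFunctions.DirichletLogDerivDisc
import Literature.NumberTheory.LFunctions.LittlewoodLemma
import Literature.Analysis.Complex.BacklundTrick
import HarnessLib

/-!
# A lower bound for `|L(σ+it, χ)|` on horizontal segments at a distance from the zeros
# (integrating the local partial fraction of `L'/L`, Montgomery–Vaughan Lemma 12.6)

Topic `Literature/NumberTheory/LFunctions`. Everything in this file is PROVED (theorems only).

For a non-principal Dirichlet character `χ` mod `q` the tree has the local partial fraction
`L'/L(s, χ) = Σ_{ρ ∈ 𝒵} m(ρ)/(s − ρ) + O(ℒ)` on the discs `|s − (2 + it)| ≤ 38/25`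
(`Literature.NumberTheory.LFunctions.DirichletDisc.exists_norm_logDeriv_sub_sum_le`, `𝒵 = discZeros χ t`
the zeros in `|s − (2+it)| ≤ 81/50`, `Σ m(ρ) ≤ Cℒ` by `exists_sum_discZeros_le`,
`ℒ = log q + log(|t| + 4)`). Integrating its real part along the horizontal segment
`[σ, 2] + it` (`½ ≤ σ ≤ 2`) — which is what Montgomery–Vaughan do to pass from Lemma 12.6 to
bounds for `log|L(s,χ)|` near the critical line (MV §12.1; Titchmarsh §9.6 for `ζ`: "`log ζ(s) =
Σ_{|t−γ|≤1} log(s − ρ) + O(log t)`") — gives: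

* `DirichletDisc.re_integral_logDeriv_le` — if every `ρ ∈ 𝒵` keeps distance `≥ d` from the segment
  (`0 < d ≤ 1`), then `Re ∫_σ^2 L'/L(x + it, χ) dx ≤ C·(1 + log(1/d))·ℒ`;
* `DirichletDisc.log_norm_LFunction_ge` — hence `log|L(σ + it, χ)| ≥ −C·(1 + log(1/d))·ℒ`
  (`|L(2 + it, χ)| ≥ ½`), i.e.
* `DirichletDisc.exp_neg_le_norm_LFunction` — **`|L(σ + it, χ)| ≥ exp(−C(1 + log(1/d))ℒ)`** for
  `½ ≤ σ ≤ 2`, with ONE absolute constant `C` (independent of `q`, `χ`, `t`, `σ`, `d`).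

The mechanism ([folklore], Jensen-type bookkeeping): writing `F = L(·,χ)`,
`F(2+it) = F(σ+it)·exp(∫_σ^2 F'/F)` along the zero-free segment (the tree's
`Literature.Analysis.Complex.eq_mul_exp_integral_logDeriv`), and for each zero
`(2+it−ρ) = (σ+it−ρ)·exp(∫_σ^2 dx/(x+it−ρ))`, so `Re∫_σ^2 dx/(x+it−ρ) = log|2+it−ρ| − log|σ+it−ρ|
≤ log(81/50) + log(1/d)`; summing with the weights `m(ρ)` and adding the `O(ℒ)` remainder over a
segment of length `≤ 3/2` gives the claim. Typical use (contour shifts to the right of the critical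
line in a window where the zeros are known to lie on `σ = ½`, e.g. Zhang's §8/§17 moves
`𝔍(α) → 𝔍(1)`): `d ≍ α`, so `|L|⁻¹ ≤ exp(O(ℒ log(1/α)))`, which any Gaussian weight
`exp(−(height/width)²)` beats.

## References

* H. L. Montgomery, R. C. Vaughan, *Multiplicative Number Theory I*, CUP 2007, Lemma 12.6 and
  §12.1. [cite: MontgomeryVaughan2007, Lemma 12.6]
* E. C. Titchmarsh, *The Theory of the Riemann Zeta-Function*, 2nd ed., §9.6 (9.6.3).
-/

noncomputable section

open Complex Set Metric Filter Topology Real MeasureTheory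

namespace Literature.NumberTheory.LFunctions.DirichletDisc

variable {q : ℕ} [NeZero q]

/-! ### The segment `[σ, 2] + it` inside the disc `|s − (2 + it)| ≤ 38/25` -/

/-- For `½ ≤ σ ≤ x ≤ 2` the point `x + it` lies in the disc `|s − (2 + it)| ≤ 38/25`.
[cite: MontgomeryVaughan2007, Lemma 12.6] -/
theorem segment_mem_closedBall {σ t x : ℝ} (hσ : 1 / 2 ≤ σ) (hx : x ∈ Icc σ 2) :
    (x : ℂ) + t * I ∈ closedBall (2 + (t : ℂ) * I) (38 / 25) :=
  mem_closedBall_of_re_mem_Icc ⟨le_trans hσ hx.1, hx.2⟩ (by simp)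

/-! ### The elementary factor: `Re ∫_σ^2 dx/(x + it − ρ) = log|2 + it − ρ| − log|σ + it − ρ|` -/

/-- For `ρ` off the segment `[σ,2] + it`:
`‖2 + it − ρ‖ = ‖σ + it − ρ‖ · exp(Re ∫_σ^2 dx/(x + it − ρ))` (the identity
`h(2+it) = h(σ+it)exp(∫ h'/h)` for `h(s) = s − ρ`) — the elementary factor of the integrated
partial fraction (Titchmarsh §9.6: `log(s − ρ)` termwise). [cite: MontgomeryVaughan2007, Lemma 12.6] -/
private theorem norm_sub_eq_mul_exp_re_integral {σ t : ℝ} (hσ2 : σ ≤ 2) {ρ : ℂ}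
    (h0 : ∀ x ∈ Icc σ 2, (x : ℂ) + t * I - ρ ≠ 0) :
    ‖(2 : ℂ) + t * I - ρ‖ =
      ‖(σ : ℂ) + t * I - ρ‖ * Real.exp ((∫ x in σ..2, 1 / ((x : ℂ) + t * I - ρ)).re) := by
  have hh : ∀ x ∈ Icc σ 2, AnalyticAt ℂ (fun s : ℂ => s - ρ) ((x : ℂ) + t * I) :=
    fun x _ => (analyticAt_id).sub analyticAt_const
  have key := Literature.Analysis.Complex.eq_mul_exp_integral_logDeriv (h := fun s : ℂ => s - ρ)
    hσ2 hh h0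
  have hderiv : ∀ x : ℝ, deriv (fun s : ℂ => s - ρ) ((x : ℂ) + t * I) = 1 := fun x => by
    rw [deriv_sub_const, deriv_id'']
  simp only [hderiv] at key
  have e : ((2 : ℝ) : ℂ) = 2 := by norm_num
  rw [e] at key
  rw [key, norm_mul, Complex.norm_exp]

/-- For `ρ` in the disc `|ρ − (2+it)| ≤ 81/50` keeping distance `≥ d` from the segment
`[σ, 2] + it` (`0 < d`): `Re ∫_σ^2 dx/(x + it − ρ) ≤ log(81/50) + log(1/d)` (the termwise bound
`log|2+it−ρ| − log|σ+it−ρ|` of the integrated partial fraction). [cite: MontgomeryVaughan2007, Lemma 12.6] -/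
private theorem re_integral_inv_sub_le {σ t d : ℝ} (hσ2 : σ ≤ 2) (hd : 0 < d) {ρ : ℂ}
    (hρ : ρ ∈ closedBall (2 + (t : ℂ) * I) (81 / 50))
    (hdist : ∀ x ∈ Icc σ 2, d ≤ ‖(x : ℂ) + t * I - ρ‖) :
    (∫ x in σ..2, 1 / ((x : ℂ) + t * I - ρ)).re ≤ Real.log (81 / 50) + Real.log (1 / d) := by
  have h0 : ∀ x ∈ Icc σ 2, (x : ℂ) + t * I - ρ ≠ 0 := fun x hx h => by
    have := hdist x hx; rw [h, norm_zero] at this; linarith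
  have key := norm_sub_eq_mul_exp_re_integral hσ2 (t := t) h0
  set R : ℝ := (∫ x in σ..2, 1 / ((x : ℂ) + t * I - ρ)).re with hR
  have hσd : d ≤ ‖(σ : ℂ) + t * I - ρ‖ := hdist σ ⟨le_rfl, hσ2⟩
  have hpos : 0 < ‖(σ : ℂ) + t * I - ρ‖ := lt_of_lt_of_le hd hσd
  have h2 : ‖(2 : ℂ) + t * I - ρ‖ ≤ 81 / 50 := by
    rw [mem_closedBall, dist_eq_norm] at hρ
    rwa [← norm_neg, neg_sub] at hρ
  -- `d · e^R ≤ |σ+it−ρ| e^R = |2+it−ρ| ≤ 81/50`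
  have h3 : d * Real.exp R ≤ 81 / 50 := by
    calc d * Real.exp R ≤ ‖(σ : ℂ) + t * I - ρ‖ * Real.exp R :=
          mul_le_mul_of_nonneg_right hσd (Real.exp_pos R).le
      _ = ‖(2 : ℂ) + t * I - ρ‖ := key.symm
      _ ≤ 81 / 50 := h2
  have h4 : Real.exp R ≤ 81 / 50 * (1 / d) := by
    rw [mul_one_div, le_div_iff₀ hd, mul_comm]; exact h3
  have h5 := Real.log_le_log (Real.exp_pos R) h4
  rwa [Real.log_exp, Real.log_mul (by norm_num) (by positivity)] at h5

/-! ### Integrating the partial fraction -/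

/-- **`Re ∫_σ^2 L'/L(x+it, χ) dx ≤ C(1 + log(1/d))ℒ`** for `½ ≤ σ ≤ 2`, `0 < d ≤ 1`, when every zero
of `L(s, χ)` (`χ ≠ χ₀`) in the disc `|s − (2+it)| ≤ 81/50` keeps distance `≥ d` from the segment
`[σ, 2] + it`; `C` absolute. (MV Lemma 12.6 integrated: the remainder contributes `≤ (3/2)C₁ℒ`,
each zero `≤ m(ρ)(log(81/50) + log(1/d))`, and `Σ m(ρ) ≤ C₂ℒ`.)
[cite: MontgomeryVaughan2007, Lemma 12.6] -/
theorem re_integral_logDeriv_le :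
    ∃ C : ℝ, 0 < C ∧ ∀ (q : ℕ) [NeZero q] (χ : DirichletCharacter ℂ q), χ ≠ 1 → ∀ t σ d : ℝ,
      1 / 2 ≤ σ → σ ≤ 2 → 0 < d → d ≤ 1 →
        (∀ ρ ∈ discZeros χ t, ∀ x ∈ Icc σ 2, d ≤ ‖(x : ℂ) + t * I - ρ‖) →
          (∫ x in σ..2, deriv χ.LFunction ((x : ℂ) + t * I) / χ.LFunction ((x : ℂ) + t * I)).re ≤
            C * (1 + Real.log (1 / d)) * (Real.log q + Real.log (|t| + 4)) := by
  obtain ⟨C₁, hC₁0, hC₁⟩ := exists_norm_logDeriv_sub_sum_le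
  obtain ⟨C₂, hC₂0, hC₂⟩ := exists_sum_discZeros_le
  refine ⟨2 * C₁ + C₂, by positivity, fun q _ χ hχ t σ d hσ hσ2 hd hd1 hdist => ?_⟩
  set ℒ : ℝ := Real.log q + Real.log (|t| + 4) with hℒ
  have hℒ1 : 1 ≤ ℒ := DirichletZFR.one_le_ell q t
  set F : ℂ → ℂ := χ.LFunction with hF
  set Z := discZeros χ t with hZ
  set m : ℂ → ℝ := fun ρ => (discDivisor χ t ρ : ℝ) with hm
  -- points of the segment: in the small disc, and not zeros
  have hmem : ∀ x ∈ Icc σ 2, (x : ℂ) + t * I ∈ closedBall (2 + (t : ℂ) * I) (38 / 25) :=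
    fun x hx => segment_mem_closedBall hσ hx
  have hF0 : ∀ x ∈ Icc σ 2, F ((x : ℂ) + t * I) ≠ 0 := by
    intro x hx h0
    have hx' : (x : ℂ) + t * I ∈ closedBall (2 + (t : ℂ) * I) (81 / 50) :=
      closedBall_subset_closedBall (by norm_num) (hmem x hx)
    have hρ : (x : ℂ) + t * I ∈ Z := (mem_discZeros hχ).2 ⟨hx', h0⟩
    have := hdist _ hρ x hx
    rw [sub_self, norm_zero] at this
    linarith
  have hρ0 : ∀ ρ ∈ Z, ∀ x ∈ Icc σ 2, (x : ℂ) + t * I - ρ ≠ 0 := fun ρ hρ x hx h => by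
    have := hdist ρ hρ x hx; rw [h, norm_zero] at this; linarith
  -- the three integrands along the segment
  set f : ℝ → ℂ := fun x => deriv F ((x : ℂ) + t * I) / F ((x : ℂ) + t * I) with hf
  set g : ℝ → ℂ := fun x => ∑ ρ ∈ Z, (discDivisor χ t ρ : ℂ) / ((x : ℂ) + t * I - ρ) with hg
  have hFan : ∀ x ∈ Icc σ 2, AnalyticAt ℂ F ((x : ℂ) + t * I) := fun x _ =>
    (DirichletCharacter.differentiable_LFunction hχ).analyticAt _
  have hfc : ContinuousOn f (Icc σ 2) := continuousOn_logDeriv_horizontal hFan hF0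
  have hfi : IntervalIntegrable f volume σ 2 := hfc.intervalIntegrable_of_Icc hσ2
  have hcont_inv : ∀ ρ ∈ Z, ContinuousOn (fun x : ℝ => 1 / ((x : ℂ) + t * I - ρ)) (Icc σ 2) := by
    intro ρ hρ
    have hc : Continuous fun x : ℝ => (x : ℂ) + t * I - ρ := by fun_prop
    exact continuousOn_const.div hc.continuousOn fun x hx => hρ0 ρ hρ x hx
  have hcont_div : ∀ ρ ∈ Z,
      ContinuousOn (fun x : ℝ => (discDivisor χ t ρ : ℂ) / ((x : ℂ) + t * I - ρ)) (Icc σ 2) := by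
    intro ρ hρ
    have hc : Continuous fun x : ℝ => (x : ℂ) + t * I - ρ := by fun_prop
    exact continuousOn_const.div hc.continuousOn fun x hx => hρ0 ρ hρ x hx
  have hint : ∀ ρ ∈ Z, IntervalIntegrable
      (fun x : ℝ => (discDivisor χ t ρ : ℂ) / ((x : ℂ) + t * I - ρ)) volume σ 2 :=
    fun ρ hρ => (hcont_div ρ hρ).intervalIntegrable_of_Icc hσ2
  have hgc : ContinuousOn g (Icc σ 2) := by
    simp only [hg]
    exact continuousOn_finsetSum Z fun ρ hρ => hcont_div ρ hρ
  have hgi : IntervalIntegrable g volume σ 2 := hgc.intervalIntegrable_of_Icc hσ2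
  -- (1) the remainder: `Re ∫ (f − g) ≤ (2 − σ) C₁ ℒ ≤ 2 C₁ ℒ`
  have hrem : (∫ x in σ..2, (f x - g x)).re ≤ 2 * C₁ * ℒ := by
    have hbound : ∀ x ∈ Icc σ 2, ‖f x - g x‖ ≤ C₁ * ℒ := fun x hx => by
      have h := hC₁ q χ hχ t _ (hmem x hx) (hF0 x hx)
      simpa only [hf, hg, logDeriv_apply] using h
    have hn : ‖∫ x in σ..2, (f x - g x)‖ ≤ C₁ * ℒ * |2 - σ| :=
      intervalIntegral.norm_integral_le_of_norm_le_const fun x hx => by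
        rw [Set.uIoc_of_le hσ2] at hx
        exact hbound x ⟨hx.1.le, hx.2⟩
    have habs : |2 - σ| ≤ 2 := by rw [abs_of_nonneg (by linarith)]; linarith
    calc (∫ x in σ..2, (f x - g x)).re ≤ ‖∫ x in σ..2, (f x - g x)‖ := Complex.re_le_norm _
      _ ≤ C₁ * ℒ * |2 - σ| := hn
      _ ≤ C₁ * ℒ * 2 := by gcongr
      _ = 2 * C₁ * ℒ := by ring
  -- (2) the zeros: `Re ∫ g = Σ m(ρ) Re ∫ dx/(x+it−ρ) ≤ Σ m(ρ) (log(81/50) + log(1/d))`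
  have hzeros : (∫ x in σ..2, g x).re ≤ C₂ * ℒ * (Real.log (81 / 50) + Real.log (1 / d)) := by
    have hswap : ∫ x in σ..2, g x =
        ∑ ρ ∈ Z, (discDivisor χ t ρ : ℂ) * ∫ x in σ..2, 1 / ((x : ℂ) + t * I - ρ) := by
      simp only [hg]
      rw [intervalIntegral.integral_finsetSum hint]
      refine Finset.sum_congr rfl fun ρ _ => ?_
      rw [← intervalIntegral.integral_const_mul]
      refine intervalIntegral.integral_congr fun x _ => ?_
      simp only [div_eq_mul_inv, one_mul]
    rw [hswap, Complex.re_sum]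
    have hterm : ∀ ρ ∈ Z,
        ((discDivisor χ t ρ : ℂ) * ∫ x in σ..2, 1 / ((x : ℂ) + t * I - ρ)).re ≤
          (discDivisor χ t ρ : ℝ) * (Real.log (81 / 50) + Real.log (1 / d)) := by
      intro ρ hρ
      have hm0 : (0 : ℝ) ≤ discDivisor χ t ρ := by exact_mod_cast discDivisor_nonneg hχ t ρ
      have hρball : ρ ∈ closedBall (2 + (t : ℂ) * I) (81 / 50) := ((mem_discZeros hχ).1 hρ).1
      have hR := re_integral_inv_sub_le hσ2 hd hρball (hdist ρ hρ)
      rw [show ((discDivisor χ t ρ : ℂ) * ∫ x in σ..2, 1 / ((x : ℂ) + t * I - ρ)).re =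
          (discDivisor χ t ρ : ℝ) * (∫ x in σ..2, 1 / ((x : ℂ) + t * I - ρ)).re by
        simp [Complex.mul_re]]
      exact mul_le_mul_of_nonneg_left hR hm0
    have hlog0 : 0 ≤ Real.log (81 / 50) + Real.log (1 / d) :=
      add_nonneg (Real.log_nonneg (by norm_num)) (Real.log_nonneg (by
        rw [le_div_iff₀ hd, one_mul]; exact hd1))
    calc ∑ ρ ∈ Z, ((discDivisor χ t ρ : ℂ) * ∫ x in σ..2, 1 / ((x : ℂ) + t * I - ρ)).re
        ≤ ∑ ρ ∈ Z, (discDivisor χ t ρ : ℝ) * (Real.log (81 / 50) + Real.log (1 / d)) :=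
          Finset.sum_le_sum hterm
      _ = (∑ ρ ∈ Z, (discDivisor χ t ρ : ℝ)) * (Real.log (81 / 50) + Real.log (1 / d)) := by
          rw [Finset.sum_mul]
      _ ≤ C₂ * ℒ * (Real.log (81 / 50) + Real.log (1 / d)) :=
          mul_le_mul_of_nonneg_right (hC₂ q χ hχ t) hlog0
  -- assembly: `∫ f = ∫ (f − g) + ∫ g`
  have hsplit : ∫ x in σ..2, f x = (∫ x in σ..2, (f x - g x)) + ∫ x in σ..2, g x := by
    rw [intervalIntegral.integral_sub hfi hgi]; ring
  have hlog81 : Real.log (81 / 50) ≤ 1 := by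
    have : Real.log (81 / 50) ≤ Real.log (Real.exp 1) :=
      Real.log_le_log (by norm_num) (by have := Real.add_one_le_exp (1:ℝ); linarith)
    rwa [Real.log_exp] at this
  have hlogd : 0 ≤ Real.log (1 / d) := Real.log_nonneg (by rw [le_div_iff₀ hd, one_mul]; exact hd1)
  change (∫ x in σ..2, f x).re ≤ (2 * C₁ + C₂) * (1 + Real.log (1 / d)) * ℒ
  rw [hsplit, Complex.add_re]
  calc (∫ x in σ..2, (f x - g x)).re + (∫ x in σ..2, g x).re
      ≤ 2 * C₁ * ℒ + C₂ * ℒ * (Real.log (81 / 50) + Real.log (1 / d)) := add_le_add hrem hzeros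
    _ ≤ 2 * C₁ * ℒ * (1 + Real.log (1 / d)) + C₂ * ℒ * (1 + Real.log (1 / d)) := by
        have h1 : 2 * C₁ * ℒ ≤ 2 * C₁ * ℒ * (1 + Real.log (1 / d)) := by
          have : 0 ≤ 2 * C₁ * ℒ := by positivity
          nlinarith
        have h2 : C₂ * ℒ * (Real.log (81 / 50) + Real.log (1 / d)) ≤
            C₂ * ℒ * (1 + Real.log (1 / d)) := by
          have : 0 ≤ C₂ * ℒ := by positivity
          gcongr
        linarith
    _ = (2 * C₁ + C₂) * (1 + Real.log (1 / d)) * ℒ := by ring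

/-- **`log|L(σ + it, χ)| ≥ −C(1 + log(1/d))ℒ`** (`½ ≤ σ ≤ 2`, `0 < d ≤ 1`, `χ ≠ χ₀`; zeros in the disc
at distance `≥ d` from `[σ,2] + it`): from `|L(2+it,χ)| ≥ ½`, the identity
`L(2+it) = L(σ+it)·exp(∫_σ^2 L'/L)` along the zero-free segment, and `re_integral_logDeriv_le`.
[cite: MontgomeryVaughan2007, Lemma 12.6] -/
theorem log_norm_LFunction_ge :
    ∃ C : ℝ, 0 < C ∧ ∀ (q : ℕ) [NeZero q] (χ : DirichletCharacter ℂ q), χ ≠ 1 → ∀ t σ d : ℝ,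
      1 / 2 ≤ σ → σ ≤ 2 → 0 < d → d ≤ 1 →
        (∀ ρ ∈ discZeros χ t, ∀ x ∈ Icc σ 2, d ≤ ‖(x : ℂ) + t * I - ρ‖) →
          χ.LFunction ((σ : ℂ) + t * I) ≠ 0 ∧
            -(C * (1 + Real.log (1 / d)) * (Real.log q + Real.log (|t| + 4))) ≤
              Real.log ‖χ.LFunction ((σ : ℂ) + t * I)‖ := by
  obtain ⟨C, hC0, hC⟩ := re_integral_logDeriv_le
  refine ⟨C + 1, by positivity, fun q _ χ hχ t σ d hσ hσ2 hd hd1 hdist => ?_⟩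
  set ℒ : ℝ := Real.log q + Real.log (|t| + 4) with hℒ
  have hℒ1 : 1 ≤ ℒ := DirichletZFR.one_le_ell q t
  have hmem : ∀ x ∈ Icc σ 2, (x : ℂ) + t * I ∈ closedBall (2 + (t : ℂ) * I) (38 / 25) :=
    fun x hx => segment_mem_closedBall hσ hx
  have hF0 : ∀ x ∈ Icc σ 2, χ.LFunction ((x : ℂ) + t * I) ≠ 0 := by
    intro x hx h0
    have hx' : (x : ℂ) + t * I ∈ closedBall (2 + (t : ℂ) * I) (81 / 50) :=
      closedBall_subset_closedBall (by norm_num) (hmem x hx)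
    have hρ : (x : ℂ) + t * I ∈ discZeros χ t := (mem_discZeros hχ).2 ⟨hx', h0⟩
    have := hdist _ hρ x hx
    rw [sub_self, norm_zero] at this
    linarith
  have hFan : ∀ x ∈ Icc σ 2, AnalyticAt ℂ χ.LFunction ((x : ℂ) + t * I) := fun x _ =>
    (DirichletCharacter.differentiable_LFunction hχ).analyticAt _
  refine ⟨hF0 σ ⟨le_rfl, hσ2⟩, ?_⟩
  -- `|L(2+it)| = |L(σ+it)| e^{Re ∫}`
  have key := Literature.Analysis.Complex.eq_mul_exp_integral_logDeriv hσ2 hFan hF0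
  have e2 : ((2 : ℝ) : ℂ) = 2 := by norm_num
  rw [e2] at key
  have hnorm : ‖χ.LFunction (2 + t * I)‖ =
      ‖χ.LFunction ((σ : ℂ) + t * I)‖ *
        Real.exp ((∫ x in σ..2, deriv χ.LFunction ((x : ℂ) + t * I) /
          χ.LFunction ((x : ℂ) + t * I)).re) := by
    rw [key, norm_mul, Complex.norm_exp]
  have hhalf : 1 / 2 ≤ ‖χ.LFunction (2 + t * I)‖ := half_le_norm_LFunction_two_add χ t
  have hpos : 0 < ‖χ.LFunction ((σ : ℂ) + t * I)‖ := norm_pos_iff.mpr (hF0 σ ⟨le_rfl, hσ2⟩)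
  have hR := hC q χ hχ t σ d hσ hσ2 hd hd1 hdist
  set R := (∫ x in σ..2, deriv χ.LFunction ((x : ℂ) + t * I) / χ.LFunction ((x : ℂ) + t * I)).re
  -- take logs: `log(1/2) ≤ log|L(σ+it)| + R`
  have h1 : Real.log (1 / 2) ≤ Real.log ‖χ.LFunction ((σ : ℂ) + t * I)‖ + R := by
    have := Real.log_le_log (by norm_num) hhalf
    rw [hnorm, Real.log_mul hpos.ne' (Real.exp_pos R).ne', Real.log_exp] at this
    exact this
  have hlog2 : -1 ≤ Real.log (1 / 2 : ℝ) := by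
    rw [one_div, Real.log_inv]
    have : Real.log 2 ≤ 1 := by
      have : Real.log 2 ≤ Real.log (Real.exp 1) :=
        Real.log_le_log (by norm_num) (by have := Real.add_one_le_exp (1:ℝ); linarith)
      rwa [Real.log_exp] at this
    linarith
  have hlogd : 0 ≤ Real.log (1 / d) := Real.log_nonneg (by rw [le_div_iff₀ hd, one_mul]; exact hd1)
  have hextra : (1 : ℝ) ≤ 1 * (1 + Real.log (1 / d)) * ℒ := by nlinarith
  nlinarith [h1, hR, hextra]

/-- **`|L(σ + it, χ)| ≥ exp(−C(1 + log(1/d))ℒ)`** — the multiplicative form of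
`log_norm_LFunction_ge`: for `χ ≠ χ₀` mod `q`, `½ ≤ σ ≤ 2`, `0 < d ≤ 1`, and all zeros of `L(s,χ)`
in `|s − (2+it)| ≤ 81/50` at distance `≥ d` from the segment `[σ, 2] + it`; `C` absolute,
`ℒ = log q + log(|t|+4)`. [cite: MontgomeryVaughan2007, Lemma 12.6] -/
theorem exp_neg_le_norm_LFunction :
    ∃ C : ℝ, 0 < C ∧ ∀ (q : ℕ) [NeZero q] (χ : DirichletCharacter ℂ q), χ ≠ 1 → ∀ t σ d : ℝ,
      1 / 2 ≤ σ → σ ≤ 2 → 0 < d → d ≤ 1 →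
        (∀ ρ ∈ discZeros χ t, ∀ x ∈ Icc σ 2, d ≤ ‖(x : ℂ) + t * I - ρ‖) →
          Real.exp (-(C * (1 + Real.log (1 / d)) * (Real.log q + Real.log (|t| + 4)))) ≤
            ‖χ.LFunction ((σ : ℂ) + t * I)‖ := by
  obtain ⟨C, hC0, hC⟩ := log_norm_LFunction_ge
  refine ⟨C, hC0, fun q _ χ hχ t σ d hσ hσ2 hd hd1 hdist => ?_⟩
  obtain ⟨hne, hlog⟩ := hC q χ hχ t σ d hσ hσ2 hd hd1 hdist
  have hpos : 0 < ‖χ.LFunction ((σ : ℂ) + t * I)‖ := norm_pos_iff.mpr hne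
  calc Real.exp (-(C * (1 + Real.log (1 / d)) * (Real.log q + Real.log (|t| + 4))))
      ≤ Real.exp (Real.log ‖χ.LFunction ((σ : ℂ) + t * I)‖) := Real.exp_le_exp.mpr hlog
    _ = ‖χ.LFunction ((σ : ℂ) + t * I)‖ := Real.exp_log hpos

/-- The hypothesis in the shape it arises in practice: if every zero of `L(s, χ)` in the disc
`|s − (2+it)| ≤ 81/50` has real part `≤ σ − d` (e.g. all such zeros lie on the critical line and
`σ ≥ ½ + d`), then each keeps distance `≥ d` from the segment `[σ, 2] + it`.
[cite: MontgomeryVaughan2007, Lemma 12.6] -/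
theorem dist_segment_of_re_le {χ : DirichletCharacter ℂ q} {t σ d : ℝ}
    (hre : ∀ ρ ∈ discZeros χ t, ρ.re ≤ σ - d) :
    ∀ ρ ∈ discZeros χ t, ∀ x ∈ Icc σ 2, d ≤ ‖(x : ℂ) + t * I - ρ‖ := by
  intro ρ hρ x hx
  have h1 := hre ρ hρ
  calc d ≤ x - ρ.re := by linarith [hx.1]
    _ = ((x : ℂ) + t * I - ρ).re := by simp
    _ ≤ ‖(x : ℂ) + t * I - ρ‖ := Complex.re_le_norm _

end Literature.NumberTheory.LFunctions.DirichletDisc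

end
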